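import Summits.QuantumAdvantage.QuantumAdvantage.Theorems.LinnikCubicClassGroupsDegreeOnePrimesEscapeQuinticA5Group
import Summits.QuantumAdvantage.QuantumAdvantage.Theorems.LinnikCubicClassGroupsDegreeOnePrimesEscapeQuinticA5Closure
import Summits.QuantumAdvantage.QuantumAdvantage.Theorems.LinnikCubicClassGroupsDegreeOnePrimesEscapeOneSidedFrobenius
import Summits.QuantumAdvantage.QuantumAdvantage.Theorems.LinnikCubicClassGroupsDegreeOnePrimesEscapeSymmetricClosure
import HarnessLib

/-!
# The least inert prime of an `A₅`-quintic (icosahedral) field is `≤ |d_K|^L`, unconditionally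

Topic `Summits/QuantumAdvantage/QuantumAdvantage/Theorems`, cell B2b-1 (linnik-cubic), PART A (gen 8);
helper toward the crux `DegreeOnePrimesEscape` (stmt-QuantumAdvantage-11543) of route
`LinnikCubicClassGroups`.  HONEST FRAMING: the value of this file is a THEOREM (kernel-checked, GRH-free,
Siegel-free, no hypothesis) — NOT summit progress.

**Theorem** (`exists_inertPrime_le_of_quintic_A5`).  There is an absolute `L > 0` such that: if `K` is a
quintic number field and `N` a Galois number field of degree `60` generated by the embedded copies of
`K` (so `Gal(N/ℚ) ≅ A₅` is the Galois group of `K` — an icosahedral quintic), then some rational prime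
`p ≤ |d_K|^L` is INERT in `K` (`p𝓞_K` prime; Frobenius a 5-cycle; density `2/5`).

Proof: the one-sided principle `exists_frobenius_mem_of_oneSided` in `G = Gal(N/ℚ)` with the subgroups
`ψ⁻¹V ≅ V₄` and `Gal(N/K') = ψ⁻¹Stab(0) ≅ A₄` (three times) and `C` = elements whose image has no fixed
point: the pointwise inequality `6 ≤ Ind_{V}1 + 3 Ind_{A₄}1 + 6·𝟙_C` on `A₅` is `quinticA5_pointwise`
(counts in `A₅` are halves of counts in `S₅`, `card_filter_even_mul_two`).  A Frobenius in `C` is a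
5-cycle (`fixedPoints_pow_of_even_derangement`), so by Perlis' dictionary every residue degree above `p`
is `≥ 5`: `p` is inert.  Only UPPER bounds for the fixed fields (degrees `15` and `5`) and the prime
number theorem are used.  Placement: existence with an explicit exponent is known (LMO 1979; Cho–Lemke
Oliver–Zaman 2025, Thm 4: `α = 1/5`); new here is the kernel-checked proof (inexplicit exponent).

References: J. C. Lagarias, H. L. Montgomery, A. M. Odlyzko, Invent. Math. 54 (1979)
[LagariasMontgomeryOdlyzko1979]; R. Perlis, J. Number Theory 9 (1977) [Perlis1977].
-/

noncomputable section

open scoped NumberField nonZeroDivisors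
open Finset Real Ideal NumberField Equiv
open Literature.NumberTheory.NumberFields Literature.NumberTheory.LFunctions
  Literature.NumberTheory.LFunctions.NumberField

namespace Summit.QuantumAdvantage.QuantumAdvantage.Theorems.DegreeOnePrimesEscape

set_option maxHeartbeats 1600000 in
/-- **The least inert prime of an icosahedral quintic field, unconditionally.** See the module
docstring. [cite: LagariasMontgomeryOdlyzko1979, Theorem 1.1] -/
theorem exists_inertPrime_le_of_quintic_A5 :
    ∃ L : ℝ, 0 < L ∧ ∀ (K : Type) [Field K] [NumberField K], Module.finrank ℚ K = 5 →
      ∀ (N : Type) [Field N] [NumberField N] [IsGalois ℚ N], Module.finrank ℚ N = 60 →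
        (⨆ f : K →ₐ[ℚ] N, f.fieldRange) = ⊤ →
        ∃ p : ℕ, p.Prime ∧ (p : ℝ) ≤ ((NumberField.discr K).natAbs : ℝ) ^ L ∧
          (Ideal.span {(p : 𝓞 K)}).IsPrime := by
  classical
  obtain ⟨L₀, hL₀, hgen⟩ := exists_frobenius_mem_of_oneSided 60 4 6 6 (by norm_num) (by norm_num)
  refine ⟨60 * L₀, by positivity, fun K _ _ hK N _ _ _ hN hsup => ?_⟩
  obtain ⟨K', e, ψ, hinj, hrange, hstab, hdN⟩ := quinticA5Closure K hK N hN hsup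
  obtain ⟨hV1, hVmul, hVinv, hVnorm, hV4, hA12, hS24, hu, hu0⟩ := kleinFour_facts
  -- the Klein four-group and its pull-back; the point stabiliser
  set V : Finset (Perm (Fin 5)) := ({1, Equiv.swap (1 : Fin 5) 2 * Equiv.swap (3 : Fin 5) 4,
    Equiv.swap (1 : Fin 5) 3 * Equiv.swap (2 : Fin 5) 4,
    Equiv.swap (1 : Fin 5) 4 * Equiv.swap (2 : Fin 5) 3} : Finset (Perm (Fin 5))) with hVdef
  let Vsub : Subgroup (Perm (Fin 5)) :=
    { carrier := {σ | σ ∈ V}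
      mul_mem' := fun {a} {b} ha hb => hVmul a ha b hb
      one_mem' := hV1
      inv_mem' := fun {a} ha => hVinv a ha }
  let V' : Subgroup (N ≃ₐ[ℚ] N) := Vsub.comap ψ
  have hV' : ∀ g, g ∈ V' ↔ ψ g ∈ V := fun g => Iff.rfl
  set S' := K'.fixingSubgroup with hS'def
  have hcardV' : Nat.card V' = 4 := by
    rw [natCard_subgroup_eq_card_filter_even ψ hinj hrange V' (· ∈ V) hV', hV4]
  have hcardS' : Nat.card S' = 12 := by
    rw [natCard_subgroup_eq_card_filter_even ψ hinj hrange S' (fun q => q 0 = 0) hstab, hA12]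
  have hG : Nat.card (N ≃ₐ[ℚ] N) = 60 := by rw [IsGalois.card_aut_eq_finrank, hN]
  have hne : ∀ S : Subgroup (N ≃ₐ[ℚ] N), Nat.card S ≠ 60 → S ≠ ⊤ := by
    intro S hS h; apply hS; rw [h, Subgroup.card_top, hG]
  -- the invariance of the two tests under the odd permutation `u = (1 2)`
  set u : Perm (Fin 5) := Equiv.swap (1 : Fin 5) 2 with hudef
  have hu0' : u⁻¹ 0 = 0 := by rw [Equiv.Perm.inv_eq_iff_eq]; exact hu0.symm
  have hQV : ∀ (y q : Perm (Fin 5)), (u * q) * y * (u * q)⁻¹ ∈ V ↔ q * y * q⁻¹ ∈ V := by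
    intro y q
    have : (u * q) * y * (u * q)⁻¹ = u * (q * y * q⁻¹) * u⁻¹ := by group
    rw [this]; exact hVnorm _
  have hQS : ∀ (y q : Perm (Fin 5)), ((u * q) * y * (u * q)⁻¹) 0 = 0 ↔ (q * y * q⁻¹) 0 = 0 := by
    intro y q
    have : (u * q) * y * (u * q)⁻¹ = u * (q * y * q⁻¹) * u⁻¹ := by group
    rw [this, Equiv.Perm.mul_apply, Equiv.Perm.mul_apply, hu0', ← hu0, (Equiv.injective u).eq_iff, hu0]
  -- halved counts
  have hhalfV : ∀ y : Perm (Fin 5),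
      2 * (Finset.univ.filter fun q : Perm (Fin 5) => Perm.sign q = 1 ∧ q * y * q⁻¹ ∈ V).card =
        (Finset.univ.filter fun q : Perm (Fin 5) => q * y * q⁻¹ ∈ V).card := fun y =>
    card_filter_even_mul_two (fun q => q * y * q⁻¹ ∈ V) u hu (fun q => hQV y q)
  have hhalfS : ∀ y : Perm (Fin 5),
      2 * (Finset.univ.filter fun q : Perm (Fin 5) => Perm.sign q = 1 ∧ (q * y * q⁻¹) 0 = 0).card =
        (Finset.univ.filter fun q : Perm (Fin 5) => (q * y * q⁻¹) 0 = 0).card := fun y =>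
    card_filter_even_mul_two (fun q => (q * y * q⁻¹) 0 = 0) u hu (fun q => hQS y q)
  -- the one-sided data in `G`
  let H : Fin 4 → Subgroup (N ≃ₐ[ℚ] N) := fun i => if i.val = 0 then V' else S'
  have hH : ∀ i, H i ≠ ⊤ := by
    intro i
    show (if i.val = 0 then V' else S') ≠ ⊤
    split_ifs
    · exact hne V' (by rw [hcardV']; norm_num)
    · exact hne S' (by rw [hcardS']; norm_num)
  have h0 : H 0 = V' := rfl
  have h1 : H 1 = S' := rfl
  have h2 : H 2 = S' := rfl
  have h3 : H 3 = S' := rfl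
  obtain ⟨p, hp, hpx, hpN, Q, hQmax, hQover, φ, hφ, hI, hφC⟩ :=
    hgen N hN H {x : N ≃ₐ[ℚ] N | (Finset.univ.filter fun i : Fin 5 => (ψ x) i = i).card = 0} hH (by
      intro x
      have hsx : Perm.sign (ψ x) = 1 := (hrange _).mp ⟨x, rfl⟩
      have key := quinticA5_pointwise (ψ x) hsx
      rw [Fin.sum_univ_four, h0, h1, h2, h3, hcardV', hcardS',
        natCard_conj_eq_card_filter_even ψ hinj hrange V' (· ∈ V) hV',
        natCard_conj_eq_card_filter_even ψ hinj hrange S' (fun q => q 0 = 0) hstab]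
      have eV := hhalfV (ψ x)
      have eS := hhalfS (ψ x)
      set a := (Finset.univ.filter fun q : Perm (Fin 5) =>
        Perm.sign q = 1 ∧ q * ψ x * q⁻¹ ∈ V).card
      set b := (Finset.univ.filter fun q : Perm (Fin 5) =>
        Perm.sign q = 1 ∧ (q * ψ x * q⁻¹) 0 = 0).card
      by_cases hfix : (Finset.univ.filter fun i : Fin 5 => (ψ x) i = i).card = 0
      · rw [if_pos hfix] at key
        have hmem : x ∈ ({x : N ≃ₐ[ℚ] N |
            (Finset.univ.filter fun i : Fin 5 => (ψ x) i = i).card = 0} : Set (N ≃ₐ[ℚ] N)) := hfix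
        rw [if_pos hmem]
        have hk : (48 : ℝ) ≤ (2 * a : ℕ) + (2 * b : ℕ) + 48 := by
          rw [eV, eS]; exact_mod_cast key
        push_cast at hk ⊢
        linarith
      · rw [if_neg hfix, add_zero] at key
        have hmem : x ∉ ({x : N ≃ₐ[ℚ] N |
            (Finset.univ.filter fun i : Fin 5 => (ψ x) i = i).card = 0} : Set (N ≃ₐ[ℚ] N)) := hfix
        rw [if_neg hmem]
        have hk : (48 : ℝ) ≤ (2 * a : ℕ) + (2 * b : ℕ) := by
          rw [eV, eS]; exact_mod_cast key
        push_cast at hk ⊢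
        linarith)
  have hφC' : (Finset.univ.filter fun i : Fin 5 => (ψ φ) i = i).card = 0 := hφC
  -- sizes
  set d : ℝ := ((NumberField.discr K).natAbs : ℝ) with hd
  have hd3 : (3 : ℝ) ≤ d := three_le_natAbs_discr_real K (by rw [hK]; norm_num)
  have hd1 : (1 : ℝ) ≤ d := by linarith
  have hpx' : (p : ℝ) ≤ d ^ ((60 : ℝ) * L₀) := by
    have hdNR : ((NumberField.discr N).natAbs : ℝ) ≤ d ^ (60 : ℝ) := by
      rw [show (60 : ℝ) = ((60 : ℕ) : ℝ) by norm_num, Real.rpow_natCast, hd]; exact_mod_cast hdN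
    calc (p : ℝ) ≤ ((NumberField.discr N).natAbs : ℝ) ^ L₀ := hpx
      _ ≤ (d ^ (60 : ℝ)) ^ L₀ := Real.rpow_le_rpow (Nat.cast_nonneg _) hdNR hL₀.le
      _ = d ^ ((60 : ℝ) * L₀) := by rw [← Real.rpow_mul (by linarith)]
  -- `p ∤ d_K`
  have hK' : Module.finrank ℚ K' = 5 := by rw [← e.toLinearEquiv.finrank_eq, hK]
  have hdisc' : NumberField.discr K' = NumberField.discr K :=
    (NumberField.discr_eq_discr_of_algEquiv K e).symm
  have hdvd : ¬ ((p : ℤ) ∣ NumberField.discr K) := fun h =>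
    hpN (h.trans (hdisc' ▸ NumberField.discr_dvd_discr K' N))
  refine ⟨p, hp, hpx', isPrime_span_of_forall_finrank_lt_two_mul hp hdvd fun f hf => ?_⟩
  rw [hK]
  -- every residue degree is `≥ 5`: the Frobenius is a 5-cycle
  have hsφ : Perm.sign (ψ φ) = 1 := (hrange _).mp ⟨φ, rfl⟩
  obtain ⟨hF2, hF3, hF4⟩ := fixedPoints_pow_of_even_derangement (ψ φ) hsφ hφC'
  have hfix : ∀ m : ℕ, 0 < m → m < 5 →
      (Finset.univ.filter fun i : Fin 5 => ((ψ φ) ^ m) i = i).card = 0 := by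
    intro m hm0 hm5
    interval_cases m
    · rw [pow_one]; exact hφC'
    · exact hF2
    · exact hF3
    · exact hF4
  rw [ArithmeticallyEquivalent.of_algEquiv e p hp] at hf
  have hf0 : 0 < f := splittingType_pos hp hf
  by_contra hlt
  have hf5 : f < 5 := by omega
  have hk := card_fixingSubgroup_mul_sum_filter_dvd K' hp Q hφ hI f
  rw [hcardS', natCard_conj_eq_card_filter_even ψ hinj hrange S' (fun q => q 0 = 0) hstab, map_pow]
    at hk
  have h2 := hhalfS ((ψ φ) ^ f)
  rw [card_filter_conj_apply_zero, hfix f hf0 hf5, mul_zero] at h2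
  have hzero : (Finset.univ.filter fun q : Perm (Fin 5) =>
      Perm.sign q = 1 ∧ (q * (ψ φ) ^ f * q⁻¹) 0 = 0).card = 0 := by omega
  rw [hzero] at hk
  have hmem : f ∈ (splittingType K' p).filter (· ∣ f) := Multiset.mem_filter.mpr ⟨hf, dvd_refl f⟩
  have hle : f ≤ ((splittingType K' p).filter (· ∣ f)).sum := Multiset.le_sum_of_mem hmem
  omega

end Summit.QuantumAdvantage.QuantumAdvantage.Theorems.DegreeOnePrimesEscape

end
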